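import Summits.CriticalPhenomena.PercolationContinuityZ3.Theorems.Transplant.SkelFrmBChoiceWindow2
import Summits.CriticalPhenomena.PercolationContinuityZ3.Theorems.Transplant.SkelFrmBChoiceReadNums
import HarnessLib

/-!
# N2 (frames-only node `SamePDropOfSkeletonFrm₁`, OPEN) — (ζ″) ledger under J23/(R-44): THE NUMBERS BEHIND THE (C) READING ROWS AT THE WIDER WINDOWS
# (`q := kgq qxQ3 = 83·n_L`, `W := kgW WxQ3 = 17·sL + 36`, `N := kgNv0 … qxQ3 WxQ3`; SkelFrmBChoiceWindow2, `BSlot.small2 = (64·s₀, 16·s₁)`), under the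
# box-slot floors `gFloorKG ≤ g`, `40·K·R′0 ≤ g`: **`m₁ + 1 ≤ 53`**, **`X₂ ≤ 137·n_L`**, **`m₂ + 1 ≤ 411`**, **`Z₀ ≤ 276·n_L`**, **`(N+1)·n_L + Z₀ ≤ 20K·n_L + 5·n_L`**,
# **`Z₁ ≤ 26·sL`**, and the one-hop row `kgFar … 0 ≤ kgTgt0` under `KGRes3` — the successor of SkelFrmBChoiceReadNums §2 (p356094; its generic §1 and
# `valsQ_floor`/`UsL_le_modulus` are imported, not restated)

* `kgFar_zero_le_kgTgt0_3`, `kgW_WxQ3_eq`, `m₁Q3_le`, `X₂Q3_le`, `m₂Q3_le`, `Z₀Q3_le`, `Z₁Q3_le`.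
NON-VACUITY: value rows at the closed tuple (`EqNumL`, the two box-slot floors).
builds on p205010 (kernel theorem, internal audit signed; external expert review pending) — nothing in this file uses p205010; NOTHING is claimed about the open
node `SamePDropOfSkeletonFrm₁`.
Lane `prim-bschramm`, seat `prim-bschramm-stmt` (gen 21); helper file (`--supports stmt-CriticalPhenomena-4575 --as helper`).
[cite: KozmaNitzan2024, §4 Lemma 12 (pp. 23–25: the corridor's boxes)] [cite: MartineauTassion2017, §4.3 Lemma 4.2]
-/

open scoped Classical

noncomputable section

namespace Summit.CriticalPhenomena.PercolationContinuityZ3.Theorems.Transplant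

namespace PlanarSkeletonFrm

namespace NegB

open Literature.Probability.Percolation Literature.Probability.LatticeModels SimpleGraph
open SkelConc (Consts)
open Skelφ (shearUnit kgSL kgΔ kgN kgFar kgX kgX₂ kgM₁ kgM₂ kgWm₂ kgWp₂ kgZ₀ kgZ₁ KGRows)
open TwoAxis.Para (modulus)
open Neg

section Vals

variable (κ : Consts) {V : Type} [DecidableEq V] [Countable V] {G : SimpleGraph V} [G.LocallyFinite] (Φ : PlanarSkeletonFrm G) (t : V) (p : unitInterval)
  (D : Skelφ.StepI.DataNS V) (g f mk : ℕ)

/-- **`h0` at the wider windows** (`ρ := 0`): the first run step fits, `kgFar … 0 ≤ kgTgt0`, under `KGRes3` (`2n + qx ≤ 102n ≪ pitch ≥ 800n`). [this work] -/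
theorem kgFar_zero_le_kgTgt0_3 (hN : EqNumL κ Φ t p D g f) (hg : gFloorKG κ Φ t p D mk ≤ g) :
    kgFar (nL κ Φ t p D g f) (ℓL κ Φ t p D g f) (hL κ Φ t p D g f) (vL κ Φ t p D g f) (kgR κ Φ t p D mk) 0 (kgq κ Φ t p D g f (qxQ3 κ Φ t p D g f))
      (kgW κ Φ t p D g f (WxQ3 κ Φ t p D g f)) 0 ≤ kgTgt0 κ Φ t p D g f mk := by
  have hx := kgRes3_Q3 κ Φ t p D g f hN
  have H := kgRows0_of κ Φ t p D g f mk (qxQ3 κ Φ t p D g f) (WxQ3 κ Φ t p D g f) hN hg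
  obtain ⟨hS, -, hS₂, -, hW2⟩ := kg_floors κ Φ t p D g f mk (WxQ3 κ Φ t p D g f) hN hg hx.hWx
  have hb := H.kgFar_zero_budget hS hS₂ hW2
  have hqx : ((qxQ3 κ Φ t p D g f : ℕ) : ℤ) ≤ 100 * (nL κ Φ t p D g f : ℤ) := by exact_mod_cast hx.hqx
  have hv := hN.v_le
  have hK := (Skelφ.NegPrm.forty_le_Kcell κ.K₀).1
  have hK' : (40 : ℤ) ≤ (Neg.K κ : ℤ) := by unfold Neg.K; exact_mod_cast hK
  have hn0 : (0 : ℤ) ≤ nL κ Φ t p D g f := by positivity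
  have hpt := (pitch_le_kgTgt0 κ Φ t p D g f mk hN).1
  have hpitch : 800 * (nL κ Φ t p D g f : ℤ) ≤ pitch κ Φ t p D g f := by unfold pitch; nlinarith
  have e1 : ((kgq κ Φ t p D g f (qxQ3 κ Φ t p D g f) : ℕ) : ℤ) = 2 * (nL κ Φ t p D g f : ℤ) + (qxQ3 κ Φ t p D g f : ℕ) := by unfold kgq; push_cast; ring
  push_cast at hb hS₂
  linarith

/-- `kgW WxQ3 = 17·sL + 36` (as an integer) and `kgq qxQ3 = 83·n_L`. [folklore] -/
theorem kgW_WxQ3_eq (hN : EqNumL κ Φ t p D g f) :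
    ((kgW κ Φ t p D g f (WxQ3 κ Φ t p D g f) : ℕ) : ℤ) = 17 * kgSL (nL κ Φ t p D g f) (ℓL κ Φ t p D g f) (hL κ Φ t p D g f) + 36 ∧
    ((kgq κ Φ t p D g f (qxQ3 κ Φ t p D g f) : ℕ) : ℤ) = 83 * (nL κ Φ t p D g f : ℤ) := by
  have hsL := ML_sub_one_le_kgSL κ Φ t p D g f hN
  have h960 := slack_floor_le_ML κ Φ t p D g
  have hM : (959 : ℤ) ≤ ML κ Φ t p D g := by
    have : 959 ≤ ML κ Φ t p D g := by omega
    exact_mod_cast this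
  have hs0 : 0 ≤ kgSL (nL κ Φ t p D g f) (ℓL κ Φ t p D g f) (hL κ Φ t p D g f) := by linarith
  constructor
  · unfold kgW WxQ3; push_cast; rw [Int.toNat_of_nonneg hs0, Int.toNat_of_nonneg (by linarith)]; ring
  · unfold kgq qxQ3; push_cast; ring

/-- **`m₁ + 1 ≤ 53`** at the wider windows (`2sL(m₁+1) ≤ 6W + 6(N+1)R′ ≤ 106sL + 219`). [this work] -/
theorem m₁Q3_le (hN : EqNumL κ Φ t p D g f) (hg : gFloorKG κ Φ t p D mk ≤ g) (hg2 : 40 * Neg.K κ * KS0.R'0 κ Φ t p D mk ≤ g) :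
    (((kgM₁ (nL κ Φ t p D g f) (ℓL κ Φ t p D g f) (hL κ Φ t p D g f) (kgR κ Φ t p D mk) 0 (kgW κ Φ t p D g f (WxQ3 κ Φ t p D g f))
      (kgNv0 κ Φ t p D g f mk (qxQ3 κ Φ t p D g f) (WxQ3 κ Φ t p D g f)) : ℕ) : ℤ)) + 1 ≤ 53 := by
  have H := kgRows0_of κ Φ t p D g f mk (qxQ3 κ Φ t p D g f) (WxQ3 κ Φ t p D g f) hN hg
  obtain ⟨hn40, hs40, hbig, hR1, hK, -⟩ := valsQ_floor κ Φ t p D g f mk hN hg hg2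
  obtain ⟨hS, -, -, -, -⟩ := kg_floors κ Φ t p D g f mk (WxQ3 κ Φ t p D g f) hN hg (kgRes3_Q3 κ Φ t p D g f hN).hWx
  have hb := H.kgM₁_budget hS (kgNv0 κ Φ t p D g f mk (qxQ3 κ Φ t p D g f) (WxQ3 κ Φ t p D g f))
  have hNle : ((kgNv0 κ Φ t p D g f mk (qxQ3 κ Φ t p D g f) (WxQ3 κ Φ t p D g f) : ℕ) : ℤ) ≤ 20 * (Neg.K κ : ℤ) + 4 := by
    exact_mod_cast kgNv0_le κ Φ t p D g f mk (qxQ3 κ Φ t p D g f) (WxQ3 κ Φ t p D g f) hN hg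
  obtain ⟨hW, -⟩ := kgW_WxQ3_eq κ Φ t p D g f hN
  unfold Skelφ.kgT₁ at hb
  rw [hW] at hb
  unfold kgR at hb ⊢
  set a := (((kgM₁ (nL κ Φ t p D g f) (ℓL κ Φ t p D g f) (hL κ Φ t p D g f) (KS0.R'0 κ Φ t p D mk) 0 (kgW κ Φ t p D g f (WxQ3 κ Φ t p D g f))
      (kgNv0 κ Φ t p D g f mk (qxQ3 κ Φ t p D g f) (WxQ3 κ Φ t p D g f)) : ℕ) : ℤ)) + 1 with ha
  set s := kgSL (nL κ Φ t p D g f) (ℓL κ Φ t p D g f) (hL κ Φ t p D g f) with hs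
  set R := ((KS0.R'0 κ Φ t p D mk : ℕ) : ℤ) with hRdef
  set Nn := ((kgNv0 κ Φ t p D g f mk (qxQ3 κ Φ t p D g f) (WxQ3 κ Φ t p D g f) : ℕ) : ℤ) with hNn
  -- 2 s a ≤ 102 s + 216 + 6 (N+1) R and 6(N+1)R ≤ 4 s + 3
  have h1 : 6 * ((Nn + 1) * R) ≤ 4 * s + 3 := by
    have : (Nn + 1) * R ≤ (20 * (Neg.K κ : ℤ) + 5) * R := mul_le_mul_of_nonneg_right (by linarith) (by linarith)
    nlinarith
  have h2 : 2 * s * a ≤ 106 * s + 219 := by nlinarith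
  have h3 : 2 * s * a < 2 * s * 54 := by linarith
  have := lt_of_mul_lt_mul_left h3 (by linarith)
  linarith

/-- **`X₂ ≤ 137·n_L`** at the wider windows (`83n + (20K+5)R′ + 53(R′ + n)`). [this work] -/
theorem X₂Q3_le (hN : EqNumL κ Φ t p D g f) (hg : gFloorKG κ Φ t p D mk ≤ g) (hg2 : 40 * Neg.K κ * KS0.R'0 κ Φ t p D mk ≤ g) :
    kgX₂ (nL κ Φ t p D g f) (ℓL κ Φ t p D g f) (hL κ Φ t p D g f) (vL κ Φ t p D g f) (kgR κ Φ t p D mk) 0 (kgq κ Φ t p D g f (qxQ3 κ Φ t p D g f))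
      (kgW κ Φ t p D g f (WxQ3 κ Φ t p D g f)) (kgNv0 κ Φ t p D g f mk (qxQ3 κ Φ t p D g f) (WxQ3 κ Φ t p D g f)) ≤ 137 * (nL κ Φ t p D g f : ℤ) := by
  have ha := m₁Q3_le κ Φ t p D g f mk hN hg hg2
  obtain ⟨hn40, -, -, hR1, hK, h8⟩ := valsQ_floor κ Φ t p D g f mk hN hg hg2
  have hNle : ((kgNv0 κ Φ t p D g f mk (qxQ3 κ Φ t p D g f) (WxQ3 κ Φ t p D g f) : ℕ) : ℤ) ≤ 20 * (Neg.K κ : ℤ) + 4 := by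
    exact_mod_cast kgNv0_le κ Φ t p D g f mk (qxQ3 κ Φ t p D g f) (WxQ3 κ Φ t p D g f) hN hg
  obtain ⟨-, hq⟩ := kgW_WxQ3_eq κ Φ t p D g f hN
  have hv := hN.v_le
  have hva : (0 : ℤ) ≤ |vL κ Φ t p D g f| := abs_nonneg _
  unfold Skelφ.kgX₂
  rw [hq]
  unfold kgR at ha ⊢
  set a := (((kgM₁ (nL κ Φ t p D g f) (ℓL κ Φ t p D g f) (hL κ Φ t p D g f) (KS0.R'0 κ Φ t p D mk) 0 (kgW κ Φ t p D g f (WxQ3 κ Φ t p D g f))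
      (kgNv0 κ Φ t p D g f mk (qxQ3 κ Φ t p D g f) (WxQ3 κ Φ t p D g f)) : ℕ) : ℤ)) + 1 with hadef
  set R := ((KS0.R'0 κ Φ t p D mk : ℕ) : ℤ) with hRdef
  set Nn := ((kgNv0 κ Φ t p D g f mk (qxQ3 κ Φ t p D g f) (WxQ3 κ Φ t p D g f) : ℕ) : ℤ) with hNn
  set n := (nL κ Φ t p D g f : ℤ) with hndef
  have ha0 : 0 ≤ a := by positivity
  have h1 : (Nn + 1) * R ≤ (20 * (Neg.K κ : ℤ) + 5) * R := mul_le_mul_of_nonneg_right (by linarith) (by linarith)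
  have h2 : a * (R + ((0 : ℕ) : ℤ) + |vL κ Φ t p D g f|) ≤ 53 * (R + n) := by
    have : R + ((0 : ℕ) : ℤ) + |vL κ Φ t p D g f| ≤ R + n := by push_cast; linarith
    calc a * (R + ((0 : ℕ) : ℤ) + |vL κ Φ t p D g f|) ≤ a * (R + n) := mul_le_mul_of_nonneg_left this ha0
      _ ≤ 53 * (R + n) := mul_le_mul_of_nonneg_right ha (by linarith)
  push_cast at h2 ⊢
  nlinarith

/-- **`m₂ + 1 ≤ 411`** at the wider windows (`2n(m₂+1) ≤ 6X₂ + 3 ≤ 822n + 3`). [this work] -/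
theorem m₂Q3_le (hN : EqNumL κ Φ t p D g f) (hg : gFloorKG κ Φ t p D mk ≤ g) (hg2 : 40 * Neg.K κ * KS0.R'0 κ Φ t p D mk ≤ g) :
    (((kgM₂ (nL κ Φ t p D g f) (ℓL κ Φ t p D g f) (hL κ Φ t p D g f) (vL κ Φ t p D g f) (kgR κ Φ t p D mk) 0 (kgq κ Φ t p D g f (qxQ3 κ Φ t p D g f))
      (kgW κ Φ t p D g f (WxQ3 κ Φ t p D g f)) (kgNv0 κ Φ t p D g f mk (qxQ3 κ Φ t p D g f) (WxQ3 κ Φ t p D g f)) : ℕ) : ℤ)) + 1 ≤ 411 := by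
  have H := kgRows0_of κ Φ t p D g f mk (qxQ3 κ Φ t p D g f) (WxQ3 κ Φ t p D g f) hN hg
  have hX := X₂Q3_le κ Φ t p D g f mk hN hg hg2
  obtain ⟨-, hSn, -, -, -⟩ := kg_floors κ Φ t p D g f mk (WxQ3 κ Φ t p D g f) hN hg (kgRes3_Q3 κ Φ t p D g f hN).hWx
  have hb := H.kgM₂_succ_budget hSn (kgNv0 κ Φ t p D g f mk (qxQ3 κ Φ t p D g f) (WxQ3 κ Φ t p D g f))
  obtain ⟨-, -, -, hR1, -, h8⟩ := valsQ_floor κ Φ t p D g f mk hN hg hg2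
  set b := (((kgM₂ (nL κ Φ t p D g f) (ℓL κ Φ t p D g f) (hL κ Φ t p D g f) (vL κ Φ t p D g f) (kgR κ Φ t p D mk) 0
      (kgq κ Φ t p D g f (qxQ3 κ Φ t p D g f)) (kgW κ Φ t p D g f (WxQ3 κ Φ t p D g f)) (kgNv0 κ Φ t p D g f mk (qxQ3 κ Φ t p D g f) (WxQ3 κ Φ t p D g f)) : ℕ) : ℤ)) + 1
    with hbdef
  have hn2 : (2 : ℤ) ≤ (nL κ Φ t p D g f : ℤ) := by
    obtain ⟨hn40, -, -, hR1', hK', -⟩ := valsQ_floor κ Φ t p D g f mk hN hg hg2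
    nlinarith
  have h3 : 2 * (nL κ Φ t p D g f : ℤ) * b < 2 * (nL κ Φ t p D g f : ℤ) * 412 := by linarith
  have := lt_of_mul_lt_mul_left h3 (by positivity)
  linarith

/-- **`Z₀ ≤ 276·n_L`** and **`(N+1)·n_L + Z₀ ≤ 20K·n_L + 5·n_L`** at the wider windows. [this work] -/
theorem Z₀Q3_le (hN : EqNumL κ Φ t p D g f) (hg : gFloorKG κ Φ t p D mk ≤ g) (hg2 : 40 * Neg.K κ * KS0.R'0 κ Φ t p D mk ≤ g) :
    kgZ₀ (nL κ Φ t p D g f) (vL κ Φ t p D g f) (kgR κ Φ t p D mk) 0 (kgq κ Φ t p D g f (qxQ3 κ Φ t p D g f))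
        (kgNv0 κ Φ t p D g f mk (qxQ3 κ Φ t p D g f) (WxQ3 κ Φ t p D g f))
        (kgM₁ (nL κ Φ t p D g f) (ℓL κ Φ t p D g f) (hL κ Φ t p D g f) (kgR κ Φ t p D mk) 0 (kgW κ Φ t p D g f (WxQ3 κ Φ t p D g f))
          (kgNv0 κ Φ t p D g f mk (qxQ3 κ Φ t p D g f) (WxQ3 κ Φ t p D g f)))
        (kgM₂ (nL κ Φ t p D g f) (ℓL κ Φ t p D g f) (hL κ Φ t p D g f) (vL κ Φ t p D g f) (kgR κ Φ t p D mk) 0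
          (kgq κ Φ t p D g f (qxQ3 κ Φ t p D g f)) (kgW κ Φ t p D g f (WxQ3 κ Φ t p D g f)) (kgNv0 κ Φ t p D g f mk (qxQ3 κ Φ t p D g f) (WxQ3 κ Φ t p D g f)))
      ≤ 276 * (nL κ Φ t p D g f : ℤ) ∧
    ((kgNv0 κ Φ t p D g f mk (qxQ3 κ Φ t p D g f) (WxQ3 κ Φ t p D g f) : ℕ) + 1 : ℤ) * (nL κ Φ t p D g f : ℤ) +
      kgZ₀ (nL κ Φ t p D g f) (vL κ Φ t p D g f) (kgR κ Φ t p D mk) 0 (kgq κ Φ t p D g f (qxQ3 κ Φ t p D g f))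
        (kgNv0 κ Φ t p D g f mk (qxQ3 κ Φ t p D g f) (WxQ3 κ Φ t p D g f))
        (kgM₁ (nL κ Φ t p D g f) (ℓL κ Φ t p D g f) (hL κ Φ t p D g f) (kgR κ Φ t p D mk) 0 (kgW κ Φ t p D g f (WxQ3 κ Φ t p D g f))
          (kgNv0 κ Φ t p D g f mk (qxQ3 κ Φ t p D g f) (WxQ3 κ Φ t p D g f)))
        (kgM₂ (nL κ Φ t p D g f) (ℓL κ Φ t p D g f) (hL κ Φ t p D g f) (vL κ Φ t p D g f) (kgR κ Φ t p D mk) 0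
          (kgq κ Φ t p D g f (qxQ3 κ Φ t p D g f)) (kgW κ Φ t p D g f (WxQ3 κ Φ t p D g f)) (kgNv0 κ Φ t p D g f mk (qxQ3 κ Φ t p D g f) (WxQ3 κ Φ t p D g f)))
      ≤ 20 * (Neg.K κ : ℤ) * (nL κ Φ t p D g f : ℤ) + 5 * (nL κ Φ t p D g f : ℤ) := by
  have H := kgRows0_of κ Φ t p D g f mk (qxQ3 κ Φ t p D g f) (WxQ3 κ Φ t p D g f) hN hg
  have hX₂ := X₂Q3_le κ Φ t p D g f mk hN hg hg2
  obtain ⟨hn40, -, -, hR1, hK, h8⟩ := valsQ_floor κ Φ t p D g f mk hN hg hg2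
  obtain ⟨-, -, hS₂, -, -⟩ := kg_floors κ Φ t p D g f mk (WxQ3 κ Φ t p D g f) hN hg (kgRes3_Q3 κ Φ t p D g f hN).hWx
  have hX := H.kgX_budget hS₂ (kgNv0 κ Φ t p D g f mk (qxQ3 κ Φ t p D g f) (WxQ3 κ Φ t p D g f))
  rw [Skelφ.kgZ₀_eq]
  -- the far edge: kgFar N ≤ tgt0 ≤ 20Kn + 2n + 4R
  have hfar := (H.kgN_spec (kgFar_zero_le_kgTgt0_3 κ Φ t p D g f mk hN hg)).1
  have hNv : kgN (nL κ Φ t p D g f) (ℓL κ Φ t p D g f) (hL κ Φ t p D g f) (vL κ Φ t p D g f) (kgR κ Φ t p D mk) 0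
      (kgq κ Φ t p D g f (qxQ3 κ Φ t p D g f)) (kgW κ Φ t p D g f (WxQ3 κ Φ t p D g f)) (kgTgt0 κ Φ t p D g f mk) =
      kgNv0 κ Φ t p D g f mk (qxQ3 κ Φ t p D g f) (WxQ3 κ Φ t p D g f) := rfl
  rw [hNv] at hfar
  have hv := hN.v_le
  have hva : (0 : ℤ) ≤ |vL κ Φ t p D g f| := abs_nonneg _
  have htgt : kgTgt0 κ Φ t p D g f mk ≤ 20 * (Neg.K κ : ℤ) * (nL κ Φ t p D g f : ℤ) + 2 * (nL κ Φ t p D g f : ℤ) + 4 * ((KS0.R'0 κ Φ t p D mk : ℕ) : ℤ) := by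
    unfold kgTgt0 pitch Skelφ.kgΔ kgR
    have e1 := Int.ediv_mul_le ((nL κ Φ t p D g f : ℤ) - 1) (b := 2) (by norm_num)
    have e2 := Int.ediv_mul_le ((nL κ Φ t p D g f : ℤ) + (8 * ((KS0.R'0 κ Φ t p D mk : ℕ) : ℤ) + 7 * ((0 : ℕ) : ℤ) + |vL κ Φ t p D g f|)) (b := 2)
      (by norm_num)
    push_cast at e1 e2 ⊢
    linarith
  unfold Skelφ.kgFar at hfar
  unfold kgR at hX hX₂ hfar ⊢
  push_cast at hX hfar ⊢
  constructor
  · linarith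
  · linarith

/-- **`Z₁ ≤ 26·sL`** at the wider windows (`7P + W + sL + (N+1)R′ + (m₁+m₂+2)R′ ≤ 7(sL+2) + 17sL + 36 + sL + (20K+5)R′ + 464R′`, `40K·R′ ≤ sL + 1`). [this work] -/
theorem Z₁Q3_le (hN : EqNumL κ Φ t p D g f) (hg : gFloorKG κ Φ t p D mk ≤ g) (hg2 : 40 * Neg.K κ * KS0.R'0 κ Φ t p D mk ≤ g) :
    kgZ₁ (nL κ Φ t p D g f) (ℓL κ Φ t p D g f) (hL κ Φ t p D g f) (kgR κ Φ t p D mk) 0 (kgW κ Φ t p D g f (WxQ3 κ Φ t p D g f))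
        (kgNv0 κ Φ t p D g f mk (qxQ3 κ Φ t p D g f) (WxQ3 κ Φ t p D g f))
        (kgM₁ (nL κ Φ t p D g f) (ℓL κ Φ t p D g f) (hL κ Φ t p D g f) (kgR κ Φ t p D mk) 0 (kgW κ Φ t p D g f (WxQ3 κ Φ t p D g f))
          (kgNv0 κ Φ t p D g f mk (qxQ3 κ Φ t p D g f) (WxQ3 κ Φ t p D g f)))
        (kgWm₂ (nL κ Φ t p D g f) (ℓL κ Φ t p D g f) (hL κ Φ t p D g f) (kgR κ Φ t p D mk) 0 (kgW κ Φ t p D g f (WxQ3 κ Φ t p D g f))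
          (kgNv0 κ Φ t p D g f mk (qxQ3 κ Φ t p D g f) (WxQ3 κ Φ t p D g f)))
        (kgWp₂ (nL κ Φ t p D g f) (ℓL κ Φ t p D g f) (hL κ Φ t p D g f) (kgR κ Φ t p D mk) 0 (kgW κ Φ t p D g f (WxQ3 κ Φ t p D g f))
          (kgNv0 κ Φ t p D g f mk (qxQ3 κ Φ t p D g f) (WxQ3 κ Φ t p D g f)))
        (kgM₂ (nL κ Φ t p D g f) (ℓL κ Φ t p D g f) (hL κ Φ t p D g f) (vL κ Φ t p D g f) (kgR κ Φ t p D mk) 0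
          (kgq κ Φ t p D g f (qxQ3 κ Φ t p D g f)) (kgW κ Φ t p D g f (WxQ3 κ Φ t p D g f)) (kgNv0 κ Φ t p D g f mk (qxQ3 κ Φ t p D g f) (WxQ3 κ Φ t p D g f)))
      ≤ 26 * kgSL (nL κ Φ t p D g f) (ℓL κ Φ t p D g f) (hL κ Φ t p D g f) := by
  have H := kgRows0_of κ Φ t p D g f mk (qxQ3 κ Φ t p D g f) (WxQ3 κ Φ t p D g f) hN hg
  have hZ := H.kgZ₁_le (kgNv0 κ Φ t p D g f mk (qxQ3 κ Φ t p D g f) (WxQ3 κ Φ t p D g f))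
  have ha := m₁Q3_le κ Φ t p D g f mk hN hg hg2
  have hb := m₂Q3_le κ Φ t p D g f mk hN hg hg2
  obtain ⟨-, hs40, hbig, hR1, hK, -⟩ := valsQ_floor κ Φ t p D g f mk hN hg hg2
  have hNle : ((kgNv0 κ Φ t p D g f mk (qxQ3 κ Φ t p D g f) (WxQ3 κ Φ t p D g f) : ℕ) : ℤ) ≤ 20 * (Neg.K κ : ℤ) + 4 := by
    exact_mod_cast kgNv0_le κ Φ t p D g f mk (qxQ3 κ Φ t p D g f) (WxQ3 κ Φ t p D g f) hN hg
  obtain ⟨hW, -⟩ := kgW_WxQ3_eq κ Φ t p D g f hN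
  have hPd := Skelφ.natDiv_le_kgSLY (one_le_of_eqNumL κ Φ t p D g f hN).1 (ℓL κ Φ t p D g f) (hL κ Φ t p D g f)
  rw [kgSLY_eq_kgSL] at hPd
  rw [hW] at hZ
  unfold kgR at hZ ha hb ⊢
  set s := kgSL (nL κ Φ t p D g f) (ℓL κ Φ t p D g f) (hL κ Φ t p D g f) with hsdef
  set R := ((KS0.R'0 κ Φ t p D mk : ℕ) : ℤ) with hRdef
  set Nn := ((kgNv0 κ Φ t p D g f mk (qxQ3 κ Φ t p D g f) (WxQ3 κ Φ t p D g f) : ℕ) : ℤ) with hNn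
  set a := (((kgM₁ (nL κ Φ t p D g f) (ℓL κ Φ t p D g f) (hL κ Φ t p D g f) (KS0.R'0 κ Φ t p D mk) 0 (kgW κ Φ t p D g f (WxQ3 κ Φ t p D g f))
      (kgNv0 κ Φ t p D g f mk (qxQ3 κ Φ t p D g f) (WxQ3 κ Φ t p D g f)) : ℕ) : ℤ)) + 1 with hadef
  set b := (((kgM₂ (nL κ Φ t p D g f) (ℓL κ Φ t p D g f) (hL κ Φ t p D g f) (vL κ Φ t p D g f) (KS0.R'0 κ Φ t p D mk) 0
      (kgq κ Φ t p D g f (qxQ3 κ Φ t p D g f)) (kgW κ Φ t p D g f (WxQ3 κ Φ t p D g f)) (kgNv0 κ Φ t p D g f mk (qxQ3 κ Φ t p D g f) (WxQ3 κ Φ t p D g f)) : ℕ) : ℤ)) + 1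
    with hbdef
  have ha0 : 0 ≤ a := by positivity
  have hb0 : 0 ≤ b := by positivity
  -- (N+1)R ≤ (20K+5)R ≤ (s+1)/2 + 5R ; (a+b)R ≤ 464 R ; 469 R ≤ 0.3 s
  have h1 : (Nn + 1) * R ≤ (20 * (Neg.K κ : ℤ) + 5) * R := mul_le_mul_of_nonneg_right (by linarith) (by linarith)
  have h2 : (a - 1 + (b - 1) + 2) * (R + ((0 : ℕ) : ℤ)) ≤ 464 * R := by
    push_cast
    have : (a - 1 + (b - 1) + 2) = a + b := by ring
    rw [this]; nlinarith
  push_cast at hZ hPd ⊢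
  nlinarith

end Vals

end NegB

end PlanarSkeletonFrm

end Summit.CriticalPhenomena.PercolationContinuityZ3.Theorems.Transplant

end
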